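import Literature.Algebra.Lie.LefschetzModuleLefschetzInvolution
import Literature.Algebra.Lie.LefschetzInvariantFormParity
import HarnessLib

/-!
# Existence of non-degenerate invariant symmetric / skew-symmetric forms: the parity sentences of Looijenga–Lunts 1997, §1 (1.16)

Topic `Literature/Algebra/Lie` (namespace `Literature.Algebra.Lie`).  Lane `lit-hodgefound` (Track 2 foundations
library), skeleton seat `lit-hodgefound-skel-1` (generation 44), row **A1-128** of
`run/shared/lean/pub/lit-hodgefound/SKELETON.md`: the "IF" / "ALWAYS ADMITS" halves of the parity sentences of
Looijenga–Lunts (1.16) — a finite-dimensional `𝔰𝔩(2)`-representation "of even parity always admits a nondegenerate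
invariant symmetric form, whereas it admits a nondegenerate invariant skew-symmetric form if and only if all
multiplicities are even.  In the case of odd parity it is just the other way around" — completing A1-123
`LefschetzStringInvariantForm.lean` (the `(-1)^k`-symmetric form of `V(k)`) and A1-125
`LefschetzInvariantFormParity.lean` (the "ONLY IF" halves), whose SCOPE blocks recorded these directions as open.
In the vocabulary of the series: `(M, h)` `ℤ`-graded (A1-88 `IsZGrading`), a Lefschetz operator `e`
(`HasLefschetzProperty h e`; by A1-88 (1.1) the same as an `𝔰𝔩₂`-triple `(e, h, f)`), finite-dimensional over a
field `K` of characteristic `0`; the MULTIPLICITY of `V(k)` in `M` is `dim P_{-k}`, `P_{-k} = Ker(e^{k+1}) ∩ M_{-k}`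
(`primitiveSpace h e k`); a form is INVARIANT when `h` and `e` are skew-adjoint for it (then so is `f`,
`exists_nondegenerate_sl2_invariant_flip_eq_smul`); SYMMETRIC / SKEW-SYMMETRIC: `φᵀ = φ` / `φᵀ = -φ`.
DEFINITIONS WITH BODIES (`stringCoord`, `HasLefschetzProperty.stringCoordTo`, `HasLefschetzProperty.stringForm`)
and PROVED theorems; no named fact, no `sorry`, no instance, no notation (D-0026 net debt `0`).
`LieRing.ofAssociativeRing` on `𝔤𝔩(M)` is enabled FILE-LOCALLY as in the rest of the series.

## Source, VERBATIM

E. Looijenga, V. A. Lunts, *A Lie algebra attached to a projective variety*, Invent. Math. **129** (1997) 361–412,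
§1 (1.16) (held TeX text `paper:arxiv-alg-geom_9604014`, p0008 L76–L83; = extracted PDF text
`paper:arxiv-alg-geom-9604014` p0016 L7):

> "The degrees that occur all have the same parity; we refer to this as the parity of `V`. Let us recall that the
> `𝔰𝔩(2)`-invariant bilinear forms on `V(k)` are generated by a nonzero `(-)^k`-symmetric form. So an finite
> dimensional `𝔰𝔩(2)`-representation of even parity always admits a nondegenerate invariant symmetric form,
> whereas it admits a nondegenerate invariant skew-symmetric form if and only if all multiplicities are even. In
> the case of odd parity it is just the other way around."

with §1 (1.3) p0005 L1–L7 ("an invariant bilinear form on `M` … `φ` is zero on `M_k × M_l` unless `k + l = 0` and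
`𝔞` preserves the form `φ` infinitesimally: `φ(e_a m, m') + φ(m, e_a m') = 0` … If `a` is a Lefschetz element,
then the Jacobson–Morozov lemma implies that `f_a` also preserves `φ` infinitesimally"), the primitive
decomposition of the proof of (1.6), p0006 L10–L12 ("Consider the primitive decomposition of `N` with respect to
`e_a`: `N = ⊕_{k≥0} ℂ[e] P_{-k}(N)`, where `P_{-k}(N) := Ker(e_a^{k+1}|N_{-k})`"), and (1.16) p0008 L85 ("The
`𝔰𝔩(2)`-triple `(e, h, f)` in `𝔤` determines a primitive decomposition of `V`").

THE PRINTED MECHANISM, as formalised here.  `M ≅ ⊕ₖ V(k) ⊗ P_{-k}` (the primitive decomposition: the string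
`p, ep, …, eᵏp` of a primitive `p ∈ P_{-k}` is a copy of `V(k)`), and on `V(k) ⊗ P_{-k}` the tensor product of
the `(-1)^k`-symmetric invariant form `ψ_k(eⁱv, eʲv) = (-1)ⁱ δ_{i+j,k}` of `V(k)` (A1-123) with a non-degenerate
bilinear form `β_k` on the multiplicity space `P_{-k}` is invariant, non-degenerate, and `ε`-symmetric when `β_k` is
`ε(-1)^k`-symmetric; a non-degenerate SYMMETRIC `β_k` always exists, a non-degenerate SKEW one exactly when
`dim P_{-k}` is even.  Summing over `k`: a non-degenerate invariant `ε`-symmetric form on `M` exists as soon as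
`dim P_{-k}` is even for every `k` with `ε(-1)^k = -1` (`exists_nondegenerate_isSkewAdjoint_flip_eq_smul`); the four
printed clauses are the cases `ε = ±1` combined with the parity hypothesis (which kills the `P_{-k}` of the wrong
parity) and with A1-125 for the "only if".  The form is written WITHOUT choosing a basis of `M`: with André's
Lefschetz involution `*_L` of `(M, h, e)` (the tree's `HasLefschetzProperty.lefschetzInvolution`, a string reversal
`s (eʲ p) = e^{k-j} p`) and `N = *_L e *_L`, the operators `C_{k,i} = (1 - eN)(Nᵏeᵏ - Nᵏ⁺¹eᵏ⁺¹)Nⁱ` are the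
STRING COORDINATES `M → P_{-k}` (`C_{k,i}(eʲ p') = δ_{ij} δ_{kk'} p'` for `p' ∈ P_{-k'}`, from the string calculus
of `LefschetzModuleStringReversal.lean`), `Σ_{k,i} eⁱ C_{k,i} = 1` is the primitive decomposition in operator form,
and `φ_β(x, y) = Σ_k Σ_{i ≤ k} (-1)ⁱ β_k(C_{k,i} x, C_{k,k-i} y)`; only the `β_k` use a basis (of `P_{-k}`).

## Rendering (dictionary)

* "`𝔰𝔩(2)`-representation `V`" with its grading: `(M, h)` with `hgr : IsZGrading h` and `L : HasLefschetzProperty h e`,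
  `[FiniteDimensional K M]`, `[CharZero K]` (the paper's standing assumptions, p0003).
* "parity": EVEN parity = `∀ m : ℤ, Odd m → degreeSpace h m = ⊥`; ODD parity = `∀ m : ℤ, Even m → degreeSpace h m = ⊥`.
* "multiplicity of `V(k)`" = `finrank K (primitiveSpace h e k)`; "all multiplicities are even" =
  `∀ k, Even (finrank K (primitiveSpace h e k))`.
* "nondegenerate invariant symmetric (skew-symmetric) form": `B : LinearMap.BilinForm K M` with `B.Nondegenerate`,
  `B.IsSkewAdjoint h`, `B.IsSkewAdjoint e`, and `B.IsSymm` (resp. `LinearMap.flip B = -B`); the general statement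
  uses `LinearMap.flip B = ε • B`, `ε = ±1`, as A1-125 does.

## Contents (all proved)

* §1 STRING COORDINATES for any string reversal `s` (`IsStringReversal h e s`): `stringCoord e s k i` (= `C_{k,i}`),
  `IsStringReversal.stringCoord_apply_pow_primitive` (`C_{k,i}(eʲ p') = δ_{ij} δ_{kk'} p'`),
  `HasLefschetzProperty.stringCoord_mem` (values in `P_{-k}`), the map `HasLefschetzProperty.stringCoordTo : M →ₗ P_{-k}`,
  and the primitive decomposition in operator form **`HasLefschetzProperty.sum_pow_mul_stringCoord`**
  (`Σ_{k < D} Σ_{i ≤ k} eⁱ C_{k,i} = 1` for `D ≥ dim M`).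
* §2 the form **`HasLefschetzProperty.stringForm`** `φ_β` attached to bilinear forms `β_k` on the `P_{-k}`:
  `bilinForm_ext_of_strings` (two bilinear forms agreeing on pairs of string vectors are equal), its values on
  strings `stringForm_apply_pow_pow` (`φ_β(eᵃp, eᵇq) = (-1)ᵃ δ_{a+b,k} β_k(p, q)`), `stringForm_apply_pow_pow_of_ne`
  (strings of different lengths are orthogonal), **invariance** `isSkewAdjoint_stringForm_h`,
  `isSkewAdjoint_stringForm_e`, **symmetry** `flip_stringForm` (`φ_βᵀ = ε φ_β` when each `β_k` is
  `ε(-1)^k`-symmetric), **non-degeneracy** `separatingLeft_stringForm` / `nondegenerate_stringForm` (when the `β_k`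
  are left-separating).
* §3 forms on the multiplicity spaces (any field): `exists_bilinForm_symm_separatingLeft` (a non-degenerate
  symmetric form on every finite-dimensional space — the dot product of a basis), `exists_bilinForm_skew_separatingLeft`
  (a non-degenerate skew form in even dimension — the standard pairing on `Fin r ⊕ Fin r`),
  `exists_bilinForm_swap_eq_mul_separatingLeft` (both).
* §4 (1.16): **`exists_nondegenerate_isSkewAdjoint_flip_eq_smul`** (MAIN: `ε = ±1`, `dim P_{-k}` even whenever
  `ε(-1)^k = -1` ⟹ a non-degenerate invariant form with `φᵀ = εφ`), `exists_nondegenerate_isSymm` /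
  `exists_nondegenerate_flip_eq_neg` (the two signs), and the PRINTED CLAUSES
  **`exists_nondegenerate_isSymm_of_even_parity`** ("even parity always admits a nondegenerate invariant symmetric
  form"), **`exists_nondegenerate_flip_eq_neg_iff_of_even_parity`** ("… skew-symmetric form if and only if all
  multiplicities are even", with A1-125), **`exists_nondegenerate_flip_eq_neg_of_odd_parity`** and
  **`exists_nondegenerate_isSymm_iff_of_odd_parity`** ("In the case of odd parity it is just the other way around");
  `exists_nondegenerate_sl2_invariant_flip_eq_smul` (the forms are invariant under the whole triple `(e, h, f)`).

## SCOPE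

(a) "generated by" (uniqueness up to scalar on `V(k)`) is A1-123 and is not restated; the classification of ALL
invariant forms on a reducible `M` (as `⊕ₖ ψ_k ⊗ β_k`) is not formalised — only existence.  (b) Parity is rendered on
the grading of `M` (the printed notion); no statement here mixes parities.  (c) Nothing here concerns complex tori
or the Hodge conjecture; the application to the classical Lefschetz pairs ((1.16), cases `A_l … D_l`) is not
formalised.

## References

* [LooijengaLunts1997] E. Looijenga, V. A. Lunts, *A Lie algebra attached to a projective variety*, Invent. Math.
  129 (1997) 361–412; arXiv:alg-geom/9604014. §1 (1.16), p. 8 L76–L85 of the held TeX text; (1.3) p. 5 L1–L7;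
  (1.6) proof, p. 6 L10–L12.
* [Andre1996Motifs] Y. André, *Pour une théorie inconditionnelle des motifs*, Publ. Math. IHÉS 83 (1996) 5–49,
  §1.1 (the Lefschetz involution `*_L`, the Lefschetz decomposition), Prop. 1.2 (the algebra `ℚ[L, *_L L *_L]`) —
  as formalised in `LefschetzModuleStringReversal.lean` / `LefschetzModuleLefschetzInvolution.lean`.
* [Kleiman1968AlgebraicCycles] S. L. Kleiman, *Algebraic cycles and the Weil conjectures*, in: Dix exposés sur la
  cohomologie des schémas (1968) 359–386, §1.4, 1.4.4 (the position projectors `eⁱNⁱ − eⁱ⁺¹Nⁱ⁺¹`).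
-/

noncomputable section

namespace Literature.Algebra.Lie

open Module Function Set
open LinearMap (BilinForm)
open HasLefschetzProperty (primitiveSpace mem_primitiveSpace_iff)

-- The commutator Lie ring of `𝔤𝔩(M) = Module.End K M`: Mathlib's reducible NON-instance, enabled file-locally
-- exactly as in `LefschetzModule.lean`.
attribute [local instance 100] LieRing.ofAssociativeRing

variable {K : Type*} [Field K] {M : Type*} [AddCommGroup M] [Module K M] {h e s : Module.End K M}

/-! ### §1 String coordinates -/

section Coord

variable (e s) in
/-- **The string coordinate `C_{k,i}`** attached to an operator `e` and a string reversal `s` (`N = s e s`):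
`C_{k,i} = (1 - eN)(Nᵏeᵏ - Nᵏ⁺¹eᵏ⁺¹)Nⁱ` — on a string vector `eʲ p` (`p ∈ P_{-k'}`) it returns `p` when `j = i`
and `k' = k`, and `0` otherwise (`stringCoord_apply_pow_primitive`): the coefficient of `M` on the copy `eⁱ P_{-k}`
of the multiplicity space `P_{-k}` sitting in position `i` of the strings `p, ep, …, eᵏp` (`p ∈ P_{-k}`).
[cite: LooijengaLunts1997, §1 (1.6) proof p0006 L10–L12 ("N = ⊕_{k≥0} ℂ[e] P_{-k}(N), where P_{-k}(N) := Ker(e_a^{k+1}|N_{-k})")]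
[cite: Andre1996Motifs, §1.1 (Lefschetz decomposition x = Σ Lᵏ x_{j-2k}) and Prop. 1.2 (the algebra ℚ[L, *_L L *_L])] -/
def stringCoord (k i : ℕ) : Module.End K M :=
  (1 - e * (s * e * s)) * (((s * e * s) ^ k * e ^ k - (s * e * s) ^ (k + 1) * e ^ (k + 1)) * (s * e * s) ^ i)

/-- Past the top of its string a primitive vector dies: `eᵐ p = 0` for `p ∈ P_{-k}`, `m > k`.
[cite: Andre1996Motifs, §1.1 (L^{d-i+1} x_i = 0 for x_i primitive)] -/
theorem pow_apply_primitive_of_lt {k : ℕ} {p : M} (hp : p ∈ primitiveSpace h e k) {m : ℕ} (hm : k < m) :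
    (e ^ m) p = 0 := by
  rw [show m = (m - (k + 1)) + (k + 1) by omega, pow_add, Module.End.mul_apply, (mem_primitiveSpace_iff.1 hp).2,
    map_zero]

namespace IsStringReversal

/-- `(1 - eN)` cuts out the bottom of each string: `(1 - eN)(eʲ p) = p` for `j = 0` and `0` for `1 ≤ j ≤ k`.
[cite: Andre1996Motifs, Prop. 1.2 (ℚ[L, *_L L *_L])] [cite: Kleiman1968AlgebraicCycles, §1.4, 1.4.4] -/
theorem one_sub_mul_conj_apply_pow_primitive (hs : IsStringReversal h e s) {k : ℕ} {p : M}
    (hp : p ∈ primitiveSpace h e k) {j : ℕ} (hj : j ≤ k) :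
    (1 - e * (s * e * s)) ((e ^ j) p) = if j = 0 then p else 0 := by
  rw [LinearMap.sub_apply, Module.End.one_apply, Module.End.mul_apply, hs.conj_apply_pow_primitive hp hj]
  split_ifs with hj0
  · rw [hj0, pow_zero, Module.End.one_apply, map_zero, sub_zero]
  · rw [← Module.End.mul_apply, ← pow_succ', Nat.sub_add_cancel (Nat.one_le_iff_ne_zero.2 hj0), sub_self]

/-- **The string coordinates on strings: `C_{k,i}(eʲ p) = p` if `j = i` and `p ∈ P_{-k}`, and `0` for the other
string vectors** (`p ∈ P_{-k'}`, `j ≤ k'`). [cite: Andre1996Motifs, §1.1 and Prop. 1.2] [cite: LooijengaLunts1997, §1 (1.6) proof p0006 L10–L12 (primitive decomposition)] -/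
theorem stringCoord_apply_pow_primitive (hs : IsStringReversal h e s) {k' : ℕ} {p : M}
    (hp : p ∈ primitiveSpace h e k') {j : ℕ} (hj : j ≤ k') (k i : ℕ) :
    stringCoord e s k i ((e ^ j) p) = if j = i ∧ k' = k then p else 0 := by
  rw [stringCoord, Module.End.mul_apply, Module.End.mul_apply, hs.conj_pow_apply_pow_primitive hp i hj]
  by_cases hij : i ≤ j
  · rw [if_pos hij, hs.coposProj_apply hp k (j - i)]
    by_cases hjk : j - i + k = k'
    · rw [if_pos hjk, hs.one_sub_mul_conj_apply_pow_primitive hp (by omega)]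
      by_cases hji : j - i = 0
      · rw [if_pos hji, if_pos ⟨by omega, by omega⟩]
      · rw [if_neg hji, if_neg (by omega)]
    · rw [if_neg hjk, map_zero, if_neg (by omega)]
  · rw [if_neg hij, map_zero, map_zero, if_neg (by omega)]

/-- In particular `C_{k,0} p = p` for `p ∈ P_{-k}`: `C_{k,0}` is the identity on `P_{-k}`.
[cite: LooijengaLunts1997, §1 (1.6) proof p0006 L10–L12 (primitive decomposition)] -/
theorem stringCoord_apply_primitive (hs : IsStringReversal h e s) {k : ℕ} {p : M}
    (hp : p ∈ primitiveSpace h e k) : stringCoord e s k 0 p = p := by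
  have h1 := hs.stringCoord_apply_pow_primitive hp (Nat.zero_le k) k 0
  rwa [pow_zero, Module.End.one_apply, if_pos ⟨rfl, rfl⟩] at h1

end IsStringReversal

namespace HasLefschetzProperty

variable [CharZero K] [FiniteDimensional K M]

/-- **`C_{k,i}` takes values in `P_{-k}`** (it does on every string vector, and the strings span `M`).
[cite: Andre1996Motifs, §1.1 (Lefschetz decomposition)] [cite: LooijengaLunts1997, §1 (1.6) proof p0006 L10–L12 (primitive decomposition)] -/
theorem stringCoord_mem (L : HasLefschetzProperty h e) (hgr : IsZGrading h) (hs : IsStringReversal h e s)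
    (k i : ℕ) (x : M) : stringCoord e s k i x ∈ primitiveSpace h e k := by
  have hx : x ∈ Submodule.span K (stringSet h e) := by rw [L.span_stringSet_eq_top hgr]; exact Submodule.mem_top
  induction hx using Submodule.span_induction with
  | mem x hx =>
    obtain ⟨k', p, j, hp, hj, rfl⟩ := hx
    rw [hs.stringCoord_apply_pow_primitive hp hj]
    split_ifs with hc
    · exact hc.2 ▸ hp
    · exact Submodule.zero_mem _
  | zero => rw [map_zero]; exact Submodule.zero_mem _
  | add x y _ _ hx hy => rw [map_add]; exact Submodule.add_mem _ hx hy
  | smul c x _ hx => rw [map_smul]; exact Submodule.smul_mem _ c hx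

/-- **The string coordinate as a map `M → P_{-k}`.** [cite: LooijengaLunts1997, §1 (1.6) proof p0006 L10–L12 ("N = ⊕_{k≥0} ℂ[e] P_{-k}(N)")] -/
def stringCoordTo (L : HasLefschetzProperty h e) (hgr : IsZGrading h) (hs : IsStringReversal h e s) (k i : ℕ) :
    M →ₗ[K] primitiveSpace h e k :=
  LinearMap.codRestrict _ (stringCoord e s k i) (L.stringCoord_mem hgr hs k i)

/-- Its underlying vector is `C_{k,i} x`. [cite: LooijengaLunts1997, §1 (1.6) proof p0006 L10–L12 (primitive decomposition)] -/
@[simp] theorem coe_stringCoordTo_apply (L : HasLefschetzProperty h e) (hgr : IsZGrading h)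
    (hs : IsStringReversal h e s) (k i : ℕ) (x : M) :
    (L.stringCoordTo hgr hs k i x : M) = stringCoord e s k i x := rfl

/-- On strings, in `P_{-k}`: `C_{k,i}(eʲ p) = p` for `p ∈ P_{-k}`, `j = i`.
[cite: LooijengaLunts1997, §1 (1.6) proof p0006 L10–L12 (primitive decomposition)] -/
theorem stringCoordTo_apply_pow_primitive_self (L : HasLefschetzProperty h e) (hgr : IsZGrading h)
    (hs : IsStringReversal h e s) {k : ℕ} {p : M} (hp : p ∈ primitiveSpace h e k) {i : ℕ} (hi : i ≤ k) :
    L.stringCoordTo hgr hs k i ((e ^ i) p) = ⟨p, hp⟩ :=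
  Subtype.ext (by rw [coe_stringCoordTo_apply, hs.stringCoord_apply_pow_primitive hp hi, if_pos ⟨rfl, rfl⟩])

/-- … and `C_{k,i}(eʲ p) = 0` for the other string vectors (`j ≠ i` or `p ∈ P_{-k'}`, `k' ≠ k`).
[cite: LooijengaLunts1997, §1 (1.6) proof p0006 L10–L12 (primitive decomposition)] -/
theorem stringCoordTo_apply_pow_primitive_of_not (L : HasLefschetzProperty h e) (hgr : IsZGrading h)
    (hs : IsStringReversal h e s) {k' : ℕ} {p : M} (hp : p ∈ primitiveSpace h e k') {j : ℕ} (hj : j ≤ k')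
    {k i : ℕ} (hne : ¬(j = i ∧ k' = k)) : L.stringCoordTo hgr hs k i ((e ^ j) p) = 0 :=
  Subtype.ext (by rw [coe_stringCoordTo_apply, hs.stringCoord_apply_pow_primitive hp hj, if_neg hne,
    Submodule.coe_zero])

/-- A primitive vector of weight `-k`, `k ≥ dim M`, is zero (`P_{-k} ⊆ M_{-k} = 0`). [cite: LooijengaLunts1997, §1 (1.1) p. 4 L58–L60 (depth)] -/
theorem primitive_eq_zero_of_finrank_le (L : HasLefschetzProperty h e) {k : ℕ} (hk : finrank K M ≤ k) {p : M}
    (hp : p ∈ primitiveSpace h e k) : p = 0 := by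
  have hbot := L.degreeSpace_eq_bot (n := -(k : ℤ)) (by rw [abs_neg, Nat.abs_cast]; exact_mod_cast hk)
  have h1 := (mem_primitiveSpace_iff.1 hp).1
  rwa [hbot, Submodule.mem_bot] at h1

/-- **The primitive (Lefschetz) decomposition in operator form: `Σ_{k < D} Σ_{i ≤ k} eⁱ C_{k,i} = 1`** for any
`D ≥ dim M` — every `x ∈ M` is the sum of its string components `eⁱ C_{k,i} x`, `C_{k,i} x ∈ P_{-k}`
("`M ≅ ⊕ₖ V(k) ⊗ P_{-k}(M)`"). [cite: LooijengaLunts1997, §1 (1.6) proof p0006 L10–L12 (primitive decomposition)] [cite: Andre1996Motifs, §1.1 ("la décomposition de Lefschetz : Hʲ(X) = ⊕ Lᵏ P^{j-2k}(X)")] -/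
theorem sum_pow_mul_stringCoord (L : HasLefschetzProperty h e) (hgr : IsZGrading h) (hs : IsStringReversal h e s)
    {D : ℕ} (hD : finrank K M ≤ D) :
    ∑ k ∈ Finset.range D, ∑ i ∈ Finset.range (k + 1), e ^ i * stringCoord e s k i = 1 := by
  refine L.linearMap_ext_of_strings hgr fun k' p hp j hj ↦ ?_
  rw [Module.End.one_apply, LinearMap.sum_apply]
  simp_rw [LinearMap.sum_apply, Module.End.mul_apply]
  by_cases hk' : k' < D
  · rw [Finset.sum_eq_single_of_mem k' (Finset.mem_range.2 hk') fun k _ hk ↦ ?_,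
      Finset.sum_eq_single_of_mem j (Finset.mem_range.2 (Nat.lt_succ_of_le hj)) fun i _ hi ↦ ?_,
      hs.stringCoord_apply_pow_primitive hp hj, if_pos ⟨rfl, rfl⟩]
    · rw [hs.stringCoord_apply_pow_primitive hp hj, if_neg (fun hc ↦ hi hc.1.symm), map_zero]
    · exact Finset.sum_eq_zero fun i _ ↦ by
        rw [hs.stringCoord_apply_pow_primitive hp hj, if_neg (fun hc ↦ hk hc.2.symm), map_zero]
  · have hp0 : p = 0 := L.primitive_eq_zero_of_finrank_le (by omega) hp
    simp [hp0]

end HasLefschetzProperty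

end Coord

/-! ### §2 The bilinear form attached to forms on the primitive spaces -/

section Form

variable [CharZero K] [FiniteDimensional K M]

namespace HasLefschetzProperty

/-- **Two bilinear forms agreeing on all pairs of string vectors are equal** (the strings span `M`;
`linearMap_ext_of_strings` twice). [cite: Andre1996Motifs, §1.1 (Lefschetz decomposition)] -/
theorem bilinForm_ext_of_strings (L : HasLefschetzProperty h e) (hgr : IsZGrading h) {B₁ B₂ : BilinForm K M}
    (hB : ∀ ⦃k₁ : ℕ⦄ ⦃p : M⦄, p ∈ primitiveSpace h e k₁ → ∀ ⦃a : ℕ⦄, a ≤ k₁ →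
      ∀ ⦃k₂ : ℕ⦄ ⦃q : M⦄, q ∈ primitiveSpace h e k₂ → ∀ ⦃b : ℕ⦄, b ≤ k₂ →
        B₁ ((e ^ a) p) ((e ^ b) q) = B₂ ((e ^ a) p) ((e ^ b) q)) : B₁ = B₂ :=
  L.linearMap_ext_of_strings hgr fun _ _ hp _ ha ↦
    L.linearMap_ext_of_strings hgr fun _ _ hq _ hb ↦ hB hp ha hq hb

/-- **The form `φ_β = Σ_{k < D} Σ_{i ≤ k} (-1)ⁱ β_k(C_{k,i} x, C_{k,k-i} y)`** built from bilinear forms `β_k` on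
the primitive spaces `P_{-k}`: on strings `φ_β(eⁱ p, eʲ q) = (-1)ⁱ δ_{i+j,k} β_k(p, q)` for `p, q ∈ P_{-k}` and
`φ_β = 0` across strings of different lengths (`stringForm_apply_pow_pow`, `stringForm_apply_pow_pow_of_ne`) —
the tensor product of the `(-1)^k`-symmetric invariant form `ψ_k(eⁱv, eʲv) = (-1)ⁱ δ_{i+j,k}` of `V(k)`
(A1-123 `LefschetzStringInvariantForm`) with `β_k` on the multiplicity space, summed over the isotypic components
("the 𝔰𝔩(2)-invariant bilinear forms on V(k) are generated by a nonzero (−)^k-symmetric form. So …").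
[cite: LooijengaLunts1997, §1 (1.16) p0008 L77–L83] -/
def stringForm (L : HasLefschetzProperty h e) (hgr : IsZGrading h) (hs : IsStringReversal h e s)
    (β : (k : ℕ) → BilinForm K (primitiveSpace h e k)) (D : ℕ) : BilinForm K M :=
  ∑ k ∈ Finset.range D, ∑ i ∈ Finset.range (k + 1),
    ((-1 : K) ^ i) • (β k).compl₁₂ (L.stringCoordTo hgr hs k i) (L.stringCoordTo hgr hs k (k - i))

variable {β : (k : ℕ) → BilinForm K (primitiveSpace h e k)} {D : ℕ}

/-- Unfolding `φ_β`. [cite: LooijengaLunts1997, §1 (1.16) p0008 L77–L83] -/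
theorem stringForm_apply (L : HasLefschetzProperty h e) (hgr : IsZGrading h) (hs : IsStringReversal h e s)
    (x y : M) : L.stringForm hgr hs β D x y = ∑ k ∈ Finset.range D, ∑ i ∈ Finset.range (k + 1),
      (-1 : K) ^ i * β k (L.stringCoordTo hgr hs k i x) (L.stringCoordTo hgr hs k (k - i) y) := by
  simp only [stringForm, LinearMap.sum_apply, LinearMap.smul_apply, LinearMap.compl₁₂_apply, smul_eq_mul]

/-- **`φ_β` against a string vector on the right**: `φ_β(x, eᵇ q) = (-1)^{k-b} β_k(C_{k,k-b} x, q)` for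
`q ∈ P_{-k}`, `b ≤ k < D` (only the component of `x` on `e^{k-b} P_{-k}` pairs with `eᵇ q`).
[cite: LooijengaLunts1997, §1 (1.16) p0008 L77–L83] -/
theorem stringForm_apply_pow_primitive_right (L : HasLefschetzProperty h e) (hgr : IsZGrading h)
    (hs : IsStringReversal h e s) (x : M) {k : ℕ} {q : M} (hq : q ∈ primitiveSpace h e k) {b : ℕ} (hb : b ≤ k)
    (hkD : k < D) :
    L.stringForm hgr hs β D x ((e ^ b) q) = (-1 : K) ^ (k - b) * β k (L.stringCoordTo hgr hs k (k - b) x) ⟨q, hq⟩ := by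
  rw [L.stringForm_apply hgr hs,
    Finset.sum_eq_single_of_mem k (Finset.mem_range.2 hkD) fun k' _ hk' ↦ ?_,
    Finset.sum_eq_single_of_mem (k - b) (Finset.mem_range.2 (by omega)) fun i hi' hi ↦ ?_,
    show k - (k - b) = b by omega, L.stringCoordTo_apply_pow_primitive_self hgr hs hq hb]
  · rw [L.stringCoordTo_apply_pow_primitive_of_not hgr hs hq hb
      (fun hc ↦ hi (by have := Finset.mem_range.1 hi'; omega)), map_zero, mul_zero]
  · exact Finset.sum_eq_zero fun i _ ↦ by
      rw [L.stringCoordTo_apply_pow_primitive_of_not hgr hs hq hb (fun hc ↦ hk' hc.2.symm), map_zero, mul_zero]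

/-- **`φ_β` against a string vector on the left**: `φ_β(eᵃ p, y) = (-1)ᵃ β_k(p, C_{k,k-a} y)` for `p ∈ P_{-k}`,
`a ≤ k < D`. [cite: LooijengaLunts1997, §1 (1.16) p0008 L77–L83] -/
theorem stringForm_apply_pow_primitive_left (L : HasLefschetzProperty h e) (hgr : IsZGrading h)
    (hs : IsStringReversal h e s) {k : ℕ} {p : M} (hp : p ∈ primitiveSpace h e k) {a : ℕ} (ha : a ≤ k)
    (hkD : k < D) (y : M) :
    L.stringForm hgr hs β D ((e ^ a) p) y = (-1 : K) ^ a * β k ⟨p, hp⟩ (L.stringCoordTo hgr hs k (k - a) y) := by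
  rw [L.stringForm_apply hgr hs,
    Finset.sum_eq_single_of_mem k (Finset.mem_range.2 hkD) fun k' _ hk' ↦ ?_,
    Finset.sum_eq_single_of_mem a (Finset.mem_range.2 (by omega)) fun i _ hi ↦ ?_,
    L.stringCoordTo_apply_pow_primitive_self hgr hs hp ha]
  · rw [L.stringCoordTo_apply_pow_primitive_of_not hgr hs hp ha (fun hc ↦ hi hc.1.symm), map_zero,
      LinearMap.zero_apply, mul_zero]
  · exact Finset.sum_eq_zero fun i _ ↦ by
      rw [L.stringCoordTo_apply_pow_primitive_of_not hgr hs hp ha (fun hc ↦ hk' hc.2.symm), map_zero,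
        LinearMap.zero_apply, mul_zero]

/-- `φ_β(eᵃ p, y) = 0` for `p ∈ P_{-k}` with `k ≥ D` (no such term in the sum). [cite: LooijengaLunts1997, §1 (1.16) p0008 L77–L83] -/
theorem stringForm_apply_pow_primitive_left_of_le (L : HasLefschetzProperty h e) (hgr : IsZGrading h)
    (hs : IsStringReversal h e s) {k : ℕ} {p : M} (hp : p ∈ primitiveSpace h e k) (hkD : D ≤ k) (a : ℕ)
    (y : M) : L.stringForm hgr hs β D ((e ^ a) p) y = 0 := by
  by_cases ha : a ≤ k
  · rw [L.stringForm_apply hgr hs]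
    refine Finset.sum_eq_zero fun k' hk' ↦ Finset.sum_eq_zero fun i _ ↦ ?_
    rw [L.stringCoordTo_apply_pow_primitive_of_not hgr hs hp ha
        (fun hc ↦ by have := Finset.mem_range.1 hk'; omega), map_zero, LinearMap.zero_apply, mul_zero]
  · rw [pow_apply_primitive_of_lt hp (not_le.1 ha), map_zero, LinearMap.zero_apply]

/-- **`φ_β` on two strings of the same length: `φ_β(eᵃ p, eᵇ q) = (-1)ᵃ δ_{a+b,k} β_k(p, q)`** for
`p, q ∈ P_{-k}`, `k < D`, and ALL `a, b` (past the top of a string the vectors vanish).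
[cite: LooijengaLunts1997, §1 (1.16) p0008 L77–L79 ("generated by a nonzero (−)^k-symmetric form")] -/
theorem stringForm_apply_pow_pow (L : HasLefschetzProperty h e) (hgr : IsZGrading h) (hs : IsStringReversal h e s)
    {k : ℕ} {p q : M} (hp : p ∈ primitiveSpace h e k) (hq : q ∈ primitiveSpace h e k) (hkD : k < D) (a b : ℕ) :
    L.stringForm hgr hs β D ((e ^ a) p) ((e ^ b) q) =
      if a + b = k then (-1 : K) ^ a * β k ⟨p, hp⟩ ⟨q, hq⟩ else 0 := by
  by_cases ha : a ≤ k
  · rw [L.stringForm_apply_pow_primitive_left hgr hs hp ha hkD]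
    by_cases hb : b ≤ k
    · by_cases hab : a + b = k
      · rw [if_pos hab, show k - a = b by omega, L.stringCoordTo_apply_pow_primitive_self hgr hs hq hb]
      · rw [if_neg hab, L.stringCoordTo_apply_pow_primitive_of_not hgr hs hq hb (fun hc ↦ hab (by omega)),
          map_zero, mul_zero]
    · rw [if_neg (by omega), pow_apply_primitive_of_lt hq (not_le.1 hb), map_zero, map_zero, mul_zero]
  · rw [if_neg (by omega), pow_apply_primitive_of_lt hp (not_le.1 ha), map_zero, LinearMap.zero_apply]

/-- **`φ_β` vanishes across strings of different lengths**: `φ_β(eᵃ p, eᵇ q) = 0` for `p ∈ P_{-k₁}`,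
`q ∈ P_{-k₂}`, `k₁ ≠ k₂` (the isotypic components are `φ_β`-orthogonal). [cite: LooijengaLunts1997, §1 (1.16) p0008 L77–L83] -/
theorem stringForm_apply_pow_pow_of_ne (L : HasLefschetzProperty h e) (hgr : IsZGrading h)
    (hs : IsStringReversal h e s) {k₁ k₂ : ℕ} {p q : M} (hp : p ∈ primitiveSpace h e k₁)
    (hq : q ∈ primitiveSpace h e k₂) (hk : k₁ ≠ k₂) (a b : ℕ) :
    L.stringForm hgr hs β D ((e ^ a) p) ((e ^ b) q) = 0 := by
  by_cases hkD : k₁ < D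
  · by_cases ha : a ≤ k₁
    · rw [L.stringForm_apply_pow_primitive_left hgr hs hp ha hkD]
      by_cases hb : b ≤ k₂
      · rw [L.stringCoordTo_apply_pow_primitive_of_not hgr hs hq hb (fun hc ↦ hk hc.2.symm), map_zero, mul_zero]
      · rw [pow_apply_primitive_of_lt hq (not_le.1 hb), map_zero, map_zero, mul_zero]
    · rw [pow_apply_primitive_of_lt hp (not_le.1 ha), map_zero, LinearMap.zero_apply]
  · exact L.stringForm_apply_pow_primitive_left_of_le hgr hs hp (not_lt.1 hkD) a _

/-- **`φ_β` is `h`-invariant**: `φ_β(hx, y) + φ_β(x, hy) = 0` — on strings `eᵃ p ∈ M_{2a-k}`, `eᵇ q ∈ M_{2b-k}`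
and `φ_β(eᵃ p, eᵇ q) ≠ 0` only for `a + b = k`, where the degrees cancel ("`φ` is zero on `M_k × M_l` unless
`k + l = 0`"). [cite: LooijengaLunts1997, §1 (1.3) p0005 L3–L4] [cite: LooijengaLunts1997, §1 (1.16) p0008 L77–L83] -/
theorem isSkewAdjoint_stringForm_h (L : HasLefschetzProperty h e) (hgr : IsZGrading h)
    (hs : IsStringReversal h e s) : (L.stringForm hgr hs β D).IsSkewAdjoint h := by
  have hdeg : ∀ {k : ℕ} {v : M}, v ∈ primitiveSpace h e k → ∀ m : ℕ,
      h ((e ^ m) v) = ((-(k : ℤ) + 2 * m : ℤ) : K) • (e ^ m) v := fun hv m ↦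
    mem_degreeSpace_iff.1 (L.pow_apply_mem (mem_primitiveSpace_iff.1 hv).1 m)
  have key : (L.stringForm hgr hs β D).compl₁₂ h LinearMap.id +
      (L.stringForm hgr hs β D).compl₁₂ LinearMap.id h = 0 := by
    refine L.bilinForm_ext_of_strings hgr fun k₁ p hp a ha k₂ q hq b hb ↦ ?_
    rw [LinearMap.add_apply, LinearMap.add_apply, LinearMap.compl₁₂_apply, LinearMap.compl₁₂_apply,
      LinearMap.id_apply, LinearMap.id_apply, LinearMap.zero_apply, LinearMap.zero_apply, hdeg hp a, hdeg hq b]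
    simp only [map_smul, LinearMap.smul_apply, smul_eq_mul]
    rw [← add_mul]
    by_cases hk : k₁ = k₂
    · subst hk
      by_cases hkD : k₁ < D
      · rw [L.stringForm_apply_pow_pow hgr hs hp hq hkD]
        split_ifs with hab
        · rw [← Int.cast_add, show (-(k₁ : ℤ) + 2 * a + (-(k₁ : ℤ) + 2 * b) : ℤ) = 0 by omega, Int.cast_zero,
            zero_mul]
        · rw [mul_zero]
      · rw [L.stringForm_apply_pow_primitive_left_of_le hgr hs hp (not_lt.1 hkD), mul_zero]
    · rw [L.stringForm_apply_pow_pow_of_ne hgr hs hp hq hk, mul_zero]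
  intro x y
  have h1 := LinearMap.congr_fun₂ key x y
  rw [LinearMap.add_apply, LinearMap.add_apply, LinearMap.compl₁₂_apply, LinearMap.compl₁₂_apply,
    LinearMap.id_apply, LinearMap.id_apply, LinearMap.zero_apply, LinearMap.zero_apply] at h1
  show L.stringForm hgr hs β D (h x) y = L.stringForm hgr hs β D x (-(h y))
  rw [map_neg]
  exact eq_neg_of_add_eq_zero_left h1

/-- **`φ_β` is `e`-invariant**: `φ_β(ex, y) + φ_β(x, ey) = 0` — on strings
`(-1)^{a+1} δ_{a+1+b,k} + (-1)ᵃ δ_{a+b+1,k} = 0` ("`𝔞` preserves the form `φ` infinitesimally: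
`φ(e_a m, m') + φ(m, e_a m') = 0`"). [cite: LooijengaLunts1997, §1 (1.3) p0005 L4–L5] [cite: LooijengaLunts1997, §1 (1.16) p0008 L77–L83] -/
theorem isSkewAdjoint_stringForm_e (L : HasLefschetzProperty h e) (hgr : IsZGrading h)
    (hs : IsStringReversal h e s) : (L.stringForm hgr hs β D).IsSkewAdjoint e := by
  have key : (L.stringForm hgr hs β D).compl₁₂ e LinearMap.id +
      (L.stringForm hgr hs β D).compl₁₂ LinearMap.id e = 0 := by
    refine L.bilinForm_ext_of_strings hgr fun k₁ p hp a ha k₂ q hq b hb ↦ ?_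
    rw [LinearMap.add_apply, LinearMap.add_apply, LinearMap.compl₁₂_apply, LinearMap.compl₁₂_apply,
      LinearMap.id_apply, LinearMap.id_apply, LinearMap.zero_apply, LinearMap.zero_apply,
      ← Module.End.mul_apply e (e ^ a), ← pow_succ', ← Module.End.mul_apply e (e ^ b), ← pow_succ']
    by_cases hk : k₁ = k₂
    · subst hk
      by_cases hkD : k₁ < D
      · rw [L.stringForm_apply_pow_pow hgr hs hp hq hkD, L.stringForm_apply_pow_pow hgr hs hp hq hkD]
        by_cases hab : a + b + 1 = k₁
        · rw [if_pos (by omega), if_pos (by omega), pow_succ]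
          ring
        · rw [if_neg (by omega), if_neg (by omega), add_zero]
      · rw [L.stringForm_apply_pow_primitive_left_of_le hgr hs hp (not_lt.1 hkD),
          L.stringForm_apply_pow_primitive_left_of_le hgr hs hp (not_lt.1 hkD), add_zero]
    · rw [L.stringForm_apply_pow_pow_of_ne hgr hs hp hq hk, L.stringForm_apply_pow_pow_of_ne hgr hs hp hq hk,
        add_zero]
  intro x y
  have h1 := LinearMap.congr_fun₂ key x y
  rw [LinearMap.add_apply, LinearMap.add_apply, LinearMap.compl₁₂_apply, LinearMap.compl₁₂_apply,
    LinearMap.id_apply, LinearMap.id_apply, LinearMap.zero_apply, LinearMap.zero_apply] at h1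
  show L.stringForm hgr hs β D (e x) y = L.stringForm hgr hs β D x (-(e y))
  rw [map_neg]
  exact eq_neg_of_add_eq_zero_left h1

/-- **`φ_β` is `ε`-symmetric when each `β_k` is `ε(-1)^k`-symmetric**: `φ_βᵀ = ε φ_β` — on strings
`(-1)ᵇ · ε(-1)ᵏ = ε(-1)ᵃ` for `a + b = k` (the `(-1)^k`-symmetry of the form of `V(k)` times the symmetry of
`β_k`). [cite: LooijengaLunts1997, §1 (1.16) p0008 L77–L83] -/
theorem flip_stringForm (L : HasLefschetzProperty h e) (hgr : IsZGrading h) (hs : IsStringReversal h e s)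
    {ε : K} (hβ : ∀ k < D, ∀ u v : primitiveSpace h e k, β k v u = ε * (-1) ^ k * β k u v) :
    LinearMap.flip (L.stringForm hgr hs β D) = ε • L.stringForm hgr hs β D := by
  refine L.bilinForm_ext_of_strings hgr fun k₁ p hp a ha k₂ q hq b hb ↦ ?_
  rw [LinearMap.flip_apply, LinearMap.smul_apply, LinearMap.smul_apply, smul_eq_mul]
  by_cases hk : k₁ = k₂
  · subst hk
    by_cases hkD : k₁ < D
    · rw [L.stringForm_apply_pow_pow hgr hs hq hp hkD, L.stringForm_apply_pow_pow hgr hs hp hq hkD]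
      by_cases hab : a + b = k₁
      · rw [if_pos (by omega), if_pos hab, hβ k₁ hkD ⟨p, hp⟩ ⟨q, hq⟩]
        have h1 : ((-1 : K) ^ b) * (-1) ^ k₁ = (-1) ^ a := by
          rw [← pow_add, show b + k₁ = a + 2 * b by omega, pow_add, pow_mul, neg_one_sq, one_pow, mul_one]
        linear_combination (ε * β k₁ ⟨p, hp⟩ ⟨q, hq⟩) * h1
      · rw [if_neg (by omega), if_neg hab, mul_zero]
    · rw [L.stringForm_apply_pow_primitive_left_of_le hgr hs hq (not_lt.1 hkD),
        L.stringForm_apply_pow_primitive_left_of_le hgr hs hp (not_lt.1 hkD), mul_zero]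
  · rw [L.stringForm_apply_pow_pow_of_ne hgr hs hq hp (Ne.symm hk), L.stringForm_apply_pow_pow_of_ne hgr hs hp hq hk,
      mul_zero]

/-- **`φ_β` is left-separating when every `β_k` is** (`D ≥ dim M`): if `φ_β(x, ·) = 0` then every string
coordinate `C_{k,i} x` vanishes (`φ_β(x, e^{k-i} q) = (-1)ⁱ β_k(C_{k,i} x, q)`), hence `x = Σ eⁱ C_{k,i} x = 0`.
[cite: LooijengaLunts1997, §1 (1.16) p0008 L77–L83] -/
theorem separatingLeft_stringForm (L : HasLefschetzProperty h e) (hgr : IsZGrading h)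
    (hs : IsStringReversal h e s) (hD : finrank K M ≤ D) (hβ : ∀ k < D, (β k).SeparatingLeft) :
    (L.stringForm hgr hs β D).SeparatingLeft := by
  intro x hx
  -- every string coordinate of `x` vanishes
  have hC : ∀ k < D, ∀ i ≤ k, L.stringCoordTo hgr hs k i x = 0 := by
    intro k hk i hi
    refine hβ k hk _ fun q ↦ ?_
    have h1 := hx ((e ^ (k - i)) (q : M))
    rw [L.stringForm_apply_pow_primitive_right hgr hs x q.2 (Nat.sub_le k i) hk,
      show k - (k - i) = i by omega] at h1
    have h2 : ((-1 : K) ^ i) ≠ 0 := pow_ne_zero _ (neg_ne_zero.2 one_ne_zero)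
    simpa using (mul_eq_zero.1 h1).resolve_left h2
  -- `x = Σ eⁱ C_{k,i} x = 0`
  have h3 := LinearMap.congr_fun (L.sum_pow_mul_stringCoord hgr hs hD) x
  rw [Module.End.one_apply, LinearMap.sum_apply] at h3
  rw [← h3]
  refine Finset.sum_eq_zero fun k hk ↦ ?_
  rw [LinearMap.sum_apply]
  refine Finset.sum_eq_zero fun i hi ↦ ?_
  rw [Module.End.mul_apply, ← L.coe_stringCoordTo_apply hgr hs,
    hC k (Finset.mem_range.1 hk) i (Nat.lt_succ_iff.1 (Finset.mem_range.1 hi)), Submodule.coe_zero, map_zero]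

/-- **`φ_β` is non-degenerate** when `D ≥ dim M`, every `β_k` is left-separating and `ε(-1)^k`-symmetric
(`φ_β` is then `ε`-symmetric, hence reflexive, and left-separating). [cite: LooijengaLunts1997, §1 (1.16) p0008 L77–L83] -/
theorem nondegenerate_stringForm (L : HasLefschetzProperty h e) (hgr : IsZGrading h)
    (hs : IsStringReversal h e s) (hD : finrank K M ≤ D) (hβ : ∀ k < D, (β k).SeparatingLeft) {ε : K}
    (hβ' : ∀ k < D, ∀ u v : primitiveSpace h e k, β k v u = ε * (-1) ^ k * β k u v) :
    (L.stringForm hgr hs β D).Nondegenerate := by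
  have hflip := L.flip_stringForm hgr hs hβ'
  have hrefl : LinearMap.IsRefl (L.stringForm hgr hs β D) := fun x y hxy ↦ by
    have h1 := LinearMap.congr_fun₂ hflip x y
    rw [LinearMap.flip_apply, LinearMap.smul_apply, LinearMap.smul_apply, smul_eq_mul, hxy, mul_zero] at h1
    exact h1
  exact hrefl.nondegenerate_iff_separatingLeft.2 (L.separatingLeft_stringForm hgr hs hD hβ)

end HasLefschetzProperty

end Form

/-! ### §3 Non-degenerate symmetric and skew-symmetric forms on the multiplicity spaces -/

section MultiplicitySpace

variable (K) {V : Type*} [AddCommGroup V] [Module K V] [FiniteDimensional K V]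

variable (V) in
/-- **Every finite-dimensional space carries a non-degenerate SYMMETRIC bilinear form**: the "dot product"
`Σᵢ xᵢ yᵢ` of a basis (any field). [folklore] [cite: LooijengaLunts1997, §1 (1.16) p0008 L79–L81 ("always admits a nondegenerate invariant symmetric form")] -/
theorem exists_bilinForm_symm_separatingLeft :
    ∃ β : BilinForm K V, (∀ x y, β y x = β x y) ∧ β.SeparatingLeft := by
  let b := Module.finBasis K V
  refine ⟨∑ i, (LinearMap.mul K K).compl₁₂ (b.coord i) (b.coord i), fun x y ↦ ?_, fun x hx ↦ ?_⟩
  · simp only [LinearMap.sum_apply, LinearMap.compl₁₂_apply, LinearMap.mul_apply', mul_comm]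
  · refine b.forall_coord_eq_zero_iff.1 fun j ↦ ?_
    have h1 := hx (b j)
    rw [LinearMap.sum_apply, LinearMap.sum_apply,
      Finset.sum_eq_single j (fun i _ hij ↦ ?_) (fun hj ↦ absurd (Finset.mem_univ j) hj),
      LinearMap.compl₁₂_apply, LinearMap.mul_apply', b.coord_apply, b.coord_apply, b.repr_self,
      Finsupp.single_eq_same, mul_one] at h1
    · rwa [b.coord_apply]
    · rw [LinearMap.compl₁₂_apply, LinearMap.mul_apply', b.coord_apply, b.coord_apply, b.repr_self,
        Finsupp.single_eq_of_ne hij, mul_zero]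

/-- **An even-dimensional space carries a non-degenerate SKEW-SYMMETRIC bilinear form**: the standard pairing
`Σᵢ (xᵢ y_{r+i} - x_{r+i} yᵢ)` of a basis indexed by `Fin r ⊕ Fin r` (any field). [folklore] [cite: LooijengaLunts1997, §1 (1.16) p0008 L81–L82 ("admits a nondegenerate invariant skew-symmetric form if and only if all multiplicities are even")] -/
theorem exists_bilinForm_skew_separatingLeft (hV : Even (finrank K V)) :
    ∃ β : BilinForm K V, (∀ x y, β y x = -β x y) ∧ β.SeparatingLeft := by
  obtain ⟨r, hr⟩ := hV
  let b : Basis (Fin r ⊕ Fin r) K V := (Module.finBasisOfFinrankEq K V hr).reindex finSumFinEquiv.symm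
  refine ⟨∑ i : Fin r, ((LinearMap.mul K K).compl₁₂ (b.coord (Sum.inl i)) (b.coord (Sum.inr i)) -
      (LinearMap.mul K K).compl₁₂ (b.coord (Sum.inr i)) (b.coord (Sum.inl i))), fun x y ↦ ?_, fun x hx ↦ ?_⟩
  · simp only [LinearMap.sum_apply, LinearMap.sub_apply, LinearMap.compl₁₂_apply, LinearMap.mul_apply']
    rw [← Finset.sum_neg_distrib]
    exact Finset.sum_congr rfl fun i _ ↦ by ring
  · -- the coordinates of `x`: `β(x, b (inr j)) = x_{inl j}`, `β(x, b (inl j)) = -x_{inr j}`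
    have hval : ∀ u v : Fin r ⊕ Fin r, b.coord u (b v) = if v = u then 1 else 0 := fun u v ↦ by
      rw [b.coord_apply, b.repr_self, Finsupp.single_apply]
    have key : ∀ v : Fin r ⊕ Fin r,
        (∑ i : Fin r, ((LinearMap.mul K K).compl₁₂ (b.coord (Sum.inl i)) (b.coord (Sum.inr i)) -
          (LinearMap.mul K K).compl₁₂ (b.coord (Sum.inr i)) (b.coord (Sum.inl i)))) x (b v) =
        ∑ i : Fin r, (b.coord (Sum.inl i) x * (if v = Sum.inr i then 1 else 0) -
          b.coord (Sum.inr i) x * (if v = Sum.inl i then 1 else 0)) := fun v ↦ by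
      simp only [LinearMap.sum_apply, LinearMap.sub_apply, LinearMap.compl₁₂_apply, LinearMap.mul_apply', hval]
    refine b.forall_coord_eq_zero_iff.1 fun u ↦ ?_
    rcases u with j | j
    · have h1 := hx (b (Sum.inr j))
      rw [key, Finset.sum_eq_single j (fun i _ hij ↦ ?_) (fun hj ↦ absurd (Finset.mem_univ j) hj),
        if_pos rfl, if_neg Sum.inr_ne_inl, mul_one, mul_zero, sub_zero] at h1
      · exact h1
      · rw [if_neg (fun h ↦ hij (Sum.inr_injective h).symm), if_neg Sum.inr_ne_inl, mul_zero, mul_zero, sub_zero]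
    · have h1 := hx (b (Sum.inl j))
      rw [key, Finset.sum_eq_single j (fun i _ hij ↦ ?_) (fun hj ↦ absurd (Finset.mem_univ j) hj),
        if_neg Sum.inl_ne_inr, if_pos rfl, mul_one, mul_zero, zero_sub, neg_eq_zero] at h1
      · exact h1
      · rw [if_neg Sum.inl_ne_inr, if_neg (fun h ↦ hij (Sum.inl_injective h).symm), mul_zero, mul_zero, sub_zero]

/-- The two cases together: for `ε' = 1`, or `ε' = -1` and `dim V` even, there is a left-separating bilinear form
`β` on `V` with `β(y, x) = ε' β(x, y)`. [folklore] [cite: LooijengaLunts1997, §1 (1.16) p0008 L79–L83] -/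
theorem exists_bilinForm_swap_eq_mul_separatingLeft {ε' : K} (hε' : ε' = 1 ∨ (ε' = -1 ∧ Even (finrank K V))) :
    ∃ β : BilinForm K V, (∀ x y, β y x = ε' * β x y) ∧ β.SeparatingLeft := by
  rcases hε' with rfl | ⟨rfl, hV⟩
  · simpa only [one_mul] using exists_bilinForm_symm_separatingLeft K V
  · simpa only [neg_one_mul] using exists_bilinForm_skew_separatingLeft K hV

end MultiplicitySpace

/-! ### §4 Looijenga–Lunts (1.16): the "if" / "always admits" halves of the parity sentences -/

section Existence

variable [CharZero K] [FiniteDimensional K M]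

/-- **MAIN THEOREM.  A finite-dimensional `𝔰𝔩₂`-representation admits a non-degenerate invariant `ε`-symmetric
form (`ε = ±1`) as soon as the multiplicity `dim P_{-k}` of `V(k)` is even for every `k` with `ε(-1)^k = -1`.**
For `(M, h)` `ℤ`-graded with a Lefschetz operator `e` over a field of characteristic `0`: there is
`φ : M × M → K` non-degenerate, `h`- and `e`-invariant, with `φᵀ = εφ` — namely `φ_β` (§2) for the Lefschetz
involution `*_L` of `(M, h, e)` and non-degenerate `ε(-1)^k`-symmetric forms `β_k` on the `P_{-k}` (§3: symmetric
always, skew in even dimension).  This is the mechanism of the printed sentence ("the 𝔰𝔩(2)-invariant bilinear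
forms on V(k) are generated by a nonzero (−)^k-symmetric form. So …"); the converse parity constraint is A1-125
`even_finrank_primitiveSpace`. [cite: LooijengaLunts1997, §1 (1.16) p0008 L77–L83] -/
theorem exists_nondegenerate_isSkewAdjoint_flip_eq_smul (hgr : IsZGrading h) (L : HasLefschetzProperty h e)
    {ε : K} (hε : ε = 1 ∨ ε = -1)
    (hmult : ∀ k : ℕ, ε * (-1) ^ k = -1 → Even (finrank K (primitiveSpace h e k))) :
    ∃ B : BilinForm K M, B.Nondegenerate ∧ B.IsSkewAdjoint h ∧ B.IsSkewAdjoint e ∧ LinearMap.flip B = ε • B := by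
  have hεk : ∀ k : ℕ, ε * (-1) ^ k = 1 ∨ (ε * (-1) ^ k = -1 ∧ Even (finrank K (primitiveSpace h e k))) := by
    intro k
    by_cases hk : ε * (-1) ^ k = -1
    · exact Or.inr ⟨hk, hmult k hk⟩
    · left
      rcases hε with rfl | rfl <;> rcases neg_one_pow_eq_or K k with h1 | h1 <;> simp_all
  choose β hβsymm hβsep using fun k ↦
    exists_bilinForm_swap_eq_mul_separatingLeft K (V := primitiveSpace h e k) (hεk k)
  have hs := L.isStringReversal_lefschetzInvolution hgr
  exact ⟨L.stringForm hgr hs β (finrank K M),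
    L.nondegenerate_stringForm hgr hs le_rfl (fun k _ ↦ hβsep k) (fun k _ u v ↦ hβsymm k u v),
    L.isSkewAdjoint_stringForm_h hgr hs, L.isSkewAdjoint_stringForm_e hgr hs,
    L.flip_stringForm hgr hs fun k _ u v ↦ hβsymm k u v⟩

/-- **Symmetric case (`ε = 1`): a non-degenerate invariant SYMMETRIC form exists as soon as the multiplicities of
the `V(k)` with `k` ODD are even.** [cite: LooijengaLunts1997, §1 (1.16) p0008 L77–L83] -/
theorem exists_nondegenerate_isSymm (hgr : IsZGrading h) (L : HasLefschetzProperty h e)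
    (hmult : ∀ k : ℕ, Odd k → Even (finrank K (primitiveSpace h e k))) :
    ∃ B : BilinForm K M, B.Nondegenerate ∧ B.IsSkewAdjoint h ∧ B.IsSkewAdjoint e ∧ B.IsSymm := by
  obtain ⟨B, hB, hh, he, hflip⟩ := exists_nondegenerate_isSkewAdjoint_flip_eq_smul hgr L (ε := 1) (Or.inl rfl)
    fun k hk ↦ hmult k (by
      rcases Nat.even_or_odd k with h1 | h1
      · rw [h1.neg_one_pow, one_mul] at hk; exact absurd hk (by norm_num)
      · exact h1)
  refine ⟨B, hB, hh, he, LinearMap.BilinForm.isSymm_def.2 fun x y ↦ ?_⟩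
  have h1 := LinearMap.congr_fun₂ hflip y x
  rw [LinearMap.flip_apply, one_smul] at h1
  exact h1

/-- **Skew case (`ε = -1`): a non-degenerate invariant SKEW-SYMMETRIC form exists as soon as the multiplicities
of the `V(k)` with `k` EVEN are even.** [cite: LooijengaLunts1997, §1 (1.16) p0008 L77–L83] -/
theorem exists_nondegenerate_flip_eq_neg (hgr : IsZGrading h) (L : HasLefschetzProperty h e)
    (hmult : ∀ k : ℕ, Even k → Even (finrank K (primitiveSpace h e k))) :
    ∃ B : BilinForm K M, B.Nondegenerate ∧ B.IsSkewAdjoint h ∧ B.IsSkewAdjoint e ∧ LinearMap.flip B = -B := by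
  obtain ⟨B, hB, hh, he, hflip⟩ := exists_nondegenerate_isSkewAdjoint_flip_eq_smul hgr L (ε := -1)
    (Or.inr rfl) fun k hk ↦ hmult k (by
      rcases Nat.even_or_odd k with h1 | h1
      · exact h1
      · rw [h1.neg_one_pow] at hk; exact absurd hk (by norm_num))
  exact ⟨B, hB, hh, he, by rw [hflip]; exact neg_one_smul K B⟩

omit [CharZero K] [FiniteDimensional K M] in
/-- The primitive space `P_{-k}` vanishes when the degree `-k` does not occur. [cite: LooijengaLunts1997, §1 (1.16) p0008 L76–L77 ("The degrees that occur all have the same parity")] -/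
theorem primitiveSpace_eq_bot_of_degreeSpace_eq_bot {k : ℕ} (hk : degreeSpace h (-(k : ℤ)) = ⊥) :
    primitiveSpace h e k = ⊥ :=
  eq_bot_iff.2 fun _ hx ↦ hk ▸ (mem_primitiveSpace_iff.1 hx).1

omit [CharZero K] [FiniteDimensional K M] in
/-- … and then its dimension, the multiplicity of `V(k)`, is `0`, an even number. [cite: LooijengaLunts1997, §1 (1.16) p0008 L76–L77] -/
theorem even_finrank_primitiveSpace_of_degreeSpace_eq_bot {k : ℕ} (hk : degreeSpace h (-(k : ℤ)) = ⊥) :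
    Even (finrank K (primitiveSpace h e k)) := by
  rw [primitiveSpace_eq_bot_of_degreeSpace_eq_bot hk, finrank_bot]
  exact Even.zero

/-- **(1.16), EVEN PARITY, first clause: "an finite dimensional `𝔰𝔩(2)`-representation of even parity always
admits a nondegenerate invariant symmetric form."**  Even parity: the odd degrees of `(M, h)` vanish.
[cite: LooijengaLunts1997, §1 (1.16) p0008 L77–L81] -/
theorem exists_nondegenerate_isSymm_of_even_parity (hgr : IsZGrading h) (L : HasLefschetzProperty h e)
    (hpar : ∀ m : ℤ, Odd m → degreeSpace h m = ⊥) :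
    ∃ B : BilinForm K M, B.Nondegenerate ∧ B.IsSkewAdjoint h ∧ B.IsSkewAdjoint e ∧ B.IsSymm :=
  exists_nondegenerate_isSymm hgr L fun _ hk ↦
    even_finrank_primitiveSpace_of_degreeSpace_eq_bot (hpar _ hk.natCast.neg)

/-- **(1.16), EVEN PARITY, second clause: "… whereas it admits a nondegenerate invariant skew-symmetric form if
and only if all multiplicities are even"** — "if" by `exists_nondegenerate_flip_eq_neg`, "only if" by A1-125
`even_finrank_primitiveSpace_of_flip_eq_neg` (even `k`) and parity (odd `k`: multiplicity `0`).
[cite: LooijengaLunts1997, §1 (1.16) p0008 L77–L82] -/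
theorem exists_nondegenerate_flip_eq_neg_iff_of_even_parity (hgr : IsZGrading h) (L : HasLefschetzProperty h e)
    (hpar : ∀ m : ℤ, Odd m → degreeSpace h m = ⊥) :
    (∃ B : BilinForm K M, B.Nondegenerate ∧ B.IsSkewAdjoint h ∧ B.IsSkewAdjoint e ∧ LinearMap.flip B = -B) ↔
      ∀ k : ℕ, Even (finrank K (primitiveSpace h e k)) := by
  refine ⟨fun ⟨B, hB, hh, he, hskew⟩ k ↦ ?_, fun hmult ↦ exists_nondegenerate_flip_eq_neg hgr L fun k _ ↦ hmult k⟩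
  rcases Nat.even_or_odd k with hk | hk
  · exact even_finrank_primitiveSpace_of_flip_eq_neg h e hgr L hh he hB hskew hk
  · exact even_finrank_primitiveSpace_of_degreeSpace_eq_bot (hpar _ hk.natCast.neg)

/-- **(1.16), ODD PARITY, first half of "it is just the other way around": an `𝔰𝔩(2)`-representation of odd
parity always admits a nondegenerate invariant SKEW-SYMMETRIC form.**  Odd parity: the even degrees vanish.
[cite: LooijengaLunts1997, §1 (1.16) p0008 L82–L83] -/
theorem exists_nondegenerate_flip_eq_neg_of_odd_parity (hgr : IsZGrading h) (L : HasLefschetzProperty h e)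
    (hpar : ∀ m : ℤ, Even m → degreeSpace h m = ⊥) :
    ∃ B : BilinForm K M, B.Nondegenerate ∧ B.IsSkewAdjoint h ∧ B.IsSkewAdjoint e ∧ LinearMap.flip B = -B :=
  exists_nondegenerate_flip_eq_neg hgr L fun _ hk ↦
    even_finrank_primitiveSpace_of_degreeSpace_eq_bot (hpar _ hk.natCast.neg)

/-- **(1.16), ODD PARITY, second half of "the other way around": an `𝔰𝔩(2)`-representation of odd parity
admits a nondegenerate invariant SYMMETRIC form if and only if all multiplicities are even** — "if" by
`exists_nondegenerate_isSymm`, "only if" by A1-125 `even_finrank_primitiveSpace_of_isSymm` (odd `k`) and parity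
(even `k`). [cite: LooijengaLunts1997, §1 (1.16) p0008 L77–L83] -/
theorem exists_nondegenerate_isSymm_iff_of_odd_parity (hgr : IsZGrading h) (L : HasLefschetzProperty h e)
    (hpar : ∀ m : ℤ, Even m → degreeSpace h m = ⊥) :
    (∃ B : BilinForm K M, B.Nondegenerate ∧ B.IsSkewAdjoint h ∧ B.IsSkewAdjoint e ∧ B.IsSymm) ↔
      ∀ k : ℕ, Even (finrank K (primitiveSpace h e k)) := by
  refine ⟨fun ⟨B, hB, hh, he, hsymm⟩ k ↦ ?_, fun hmult ↦ exists_nondegenerate_isSymm hgr L fun k _ ↦ hmult k⟩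
  rcases Nat.even_or_odd k with hk | hk
  · exact even_finrank_primitiveSpace_of_degreeSpace_eq_bot (hpar _ hk.natCast.neg)
  · exact even_finrank_primitiveSpace_of_isSymm h e hgr L hh he hB hsymm hk

/-- **The whole `𝔰𝔩₂`-triple preserves the forms**: each form above is also invariant under the partner
`f = HasLefschetzProperty.dual` of `e` (a non-degenerate form invariant under `h` and `e` is invariant under `f`,
A1-88 `isSkewAdjoint_dual`) — so "invariant" may be read as `𝔰𝔩(2)`-invariant, as printed.
[cite: LooijengaLunts1997, §1 (1.3) p0005 L5–L7 ("the Jacobson–Morozov lemma implies that f_a also preserves φ infinitesimally")] [cite: LooijengaLunts1997, §1 (1.16) p0008 L77–L83] -/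
theorem exists_nondegenerate_sl2_invariant_flip_eq_smul (hgr : IsZGrading h) (L : HasLefschetzProperty h e)
    (h0 : h ≠ 0) {ε : K} (hε : ε = 1 ∨ ε = -1)
    (hmult : ∀ k : ℕ, ε * (-1) ^ k = -1 → Even (finrank K (primitiveSpace h e k))) :
    ∃ B : BilinForm K M, B.Nondegenerate ∧ B.IsSkewAdjoint h ∧ B.IsSkewAdjoint e ∧
      B.IsSkewAdjoint (L.dual hgr) ∧ LinearMap.flip B = ε • B := by
  obtain ⟨B, hB, hh, he, hflip⟩ := exists_nondegenerate_isSkewAdjoint_flip_eq_smul hgr L hε hmult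
  exact ⟨B, hB, hh, he, L.isSkewAdjoint_dual hgr h0 hB hh he, hflip⟩

end Existence

end Literature.Algebra.Lie
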